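import Literature.MathematicalPhysics.QuantumFieldTheory.Balaban1983to89.Node00.CriticalOnFibreGauge
import Literature.MathematicalPhysics.QuantumFieldTheory.Balaban1983to89.B15Claim189CubePin
import Literature.MathematicalPhysics.QuantumFieldTheory.Balaban1983to89.B8Ineq132
import Literature.MathematicalPhysics.QuantumFieldTheory.Balaban1983to89.B7Prop1Local

/-!
# NODE 00 — THE TORUS→`ℤᵈ` TWIN, FILE 1: the PERIODIC LIFT of the record's torus gauge fields `U : GaugeField (F.P K) 0 (SU N)` along the universal
# cover `π = B15Eq112TorusCover.cover` to n05-a's `ℤᵈ × M_N(ℂ)ˣ` carriers, and the DICTIONARY for [6] (1.2), (1.7), (1.9): plaquette fields, the covariant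
# co-divergence, «p ∈ Ω_j» ∕ «b ∈ Ω_j», `B8Ineq132.CondAt` ∕ `InAk` READ FROM the torus class bounds `PlaqSmallOn (plaqsOf ·)` ∕ `Sect2.CoDivSmallOn (bondsOf ·)`

Cell `pub-ymgap`, seat `pub-ymgap-dag-n07-e` generation 10 (R141 (C) s3 «alternative currency — torus-vs-box twin», DAG node N07 = [15]; INBOX STARTED +
INTENT-25 of 2026-08-27 ≈13:57Z).  NEW leaf; CONSUMED BY NAME, nothing modified: r15's `B15Eq112TorusCover.cover` (with `B15Claim189CubePin.cover_add_single`),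
n05-a's `B7Prop1Explicit.(Site, e, hol, stepHol, plaqWord, gaugeAct)`, `B7Prop1Local.hol_plaqWord_eq`, `B7Prop2Explicit.unitaryUnits`, lit-balaban's
`B8Ineq132.(plaqF, covDeriv, covDiv, PlaqTouches, BondTouches, CondAt, InAk)`, node00-def-P11's `Sect2.(plaqMat, coDivTerm, coDivSum, CoDivSmallOn,
omegaPlaqsTop, omegaBondsTop)`, def-R's `omegaPlaqs`, this seat's `ιSU`, `dist1_su_eq_norm` (g9), r11's `B8Eq17ClassAkV1.plaqsOf`, r12's
`B15DeterminingSets.bondsOf`.  `--kind definition --supports stmt-QuantumFields-20506` (K0⁶, WORDS-142).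
[15] = [Balaban1985Variational]; [6] = [Balaban1985RegularSpaces]; [I] = [Balaban1987RG1]; [III] = [Balaban1988Convergent]; [3] = [Balaban1985Averaging].

WHY.  On the K0 road the (9)-half of [15] Theorem 1 is the named fact `Node00.Gauge152OfClassTopStep F N Sup M B₉ a₀` (this seat's `CriticalOnFibreGauge` §4):
[15] (152) p. 301 = [6] Theorem 2 ∕ Proposition 6 applied on the collared cube, STATED ON THE TORUS objects of record (`GaugeField (F.P K) 0 (SU N)`, `PlaqSmallOn`,
`Sect2.CoDivSmallOn`, `cubeEnl`).  [6] Proposition 6 is IN THE TREE at NODE 00's `ℤᵈ` objects (node00-def-cube's `Node00.zdCub ∕ GaugedBoundB8`, n05-c ∕ n05-e's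
`B8Prop6CubeMember*`, over n05-a's `ZdIdx`), for configurations `V : ℤᵈ → Fin d → 𝔸ˣ` in the class `B8Ineq132.InAk L k η α Ω V`.  [15] p. 300 L31 – p. 301 L25
((144)–(152)) is verbatim «we repeat all the constructions of the Sect. F in [6]» on the cube.  The honest bridge between the two typings is therefore the
periodic lift along the universal cover (the torus cubes of record ARE cover images of `ℤᵈ` boxes: def-R's `cubeEnl P s a n = cover P '' cubeExt s a (n·s)`), and
THIS FILE is its dictionary; the ambient `ZdIdx` member, the `CubeB8` datum of a grid cube and the transfer of Prop. 6's conclusions back to the torus letters are the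
sequel files (INTENT-25 programme, FILES 26–27).

WHAT IS PROVED (kernel; `P : Params` any torus of record, `N ≥ 1`; `π = cover P`; `V = zdLift N U`, `V x μ = ιSU N (U ⟨π x, μ⟩)`).
§1 `zdLift` (1 def) · `zdLift_apply` · `cover_add_e` ∕ `cover_sub_e` (`π (x ± e_μ) = (π x) ± e_μ`) · `zdLift_add_pmul` (deck periodicity) · `zdLift_mem_unitaryUnits` ·
   `zdLift_gaugeAct` (the lift intertwines the gauge actions (8) of [3]: `zdLift (U^g) = (zdLift U)^{ιSU ∘ g ∘ π}`) · `hol_plaqWord_swap` (reversed orientation =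
   inverse holonomy, any group) · ★ `plaqF_zdLift_of_lt` ∕ `plaqF_zdLift_of_gt` ([6] (1.2)'s `F_{μν}(x)` of the lift IS the embedded torus plaquette variable
   `ιSU (U(∂p_{μν}(π x)))`, resp. its inverse) · ★ `norm_plaqF_zdLift_sub_one_of_lt ∕ _of_gt` (`‖F_{μν}(x) − 1‖ = dist1 (U(∂p))`).
§2 `covDeriv_zdLift_plaqF` (one term of (1.2) = `η⁻¹ • Sect2.coDivTerm`) · ★★ `covDiv_zdLift` ([6] (1.2) of the lift IS `η⁻¹ • Sect2.coDivSum U (π x) μ` — the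
   lattice Yang–Mills current of node00-def-P11's FILE 9, read on the cover) · `norm_covDiv_zdLift`.
§3 `mem_plaqsOf_image_of_plaqTouches(_swap)` ∕ `mem_bondsOf_image_of_bondTouches` («p ∈ Y», «b ∈ Y» on the cover ⇒ the torus plaquette ∕ bond meets `π '' Y`).
§4 ★★ `condAt_zdLift` ([6] (1.7) ∧ (1.9) at scale `j` on a cover set `Y`, i.e. `B8Ineq132.CondAt L η α j Y (zdLift U)`, FROM the torus bounds
   `PlaqSmallOn (plaqsOf (π '' Y)) (α·L^{−2j}) U` and `Sect2.CoDivSmallOn (bondsOf (π '' Y)) (α·L^{−3j}) U`; the spacing `η > 0` CANCELS, as in def-P11's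
   `Record12BgRowCoDivBridge`) · `condAt_zdLift_eta` (the same in the record's `P.eta j` currency) · ★★ `inAk_zdLift` (levelwise ⇒ `InAk L k η α Ω′ (zdLift U)`) ·
   ★★ `inAk_zdLift_of_top` (THE READING USED BY THE SEQUEL: the token-style hypotheses of `Gauge152OfClassTopStep` — `PlaqSmallOn (Sect2.omegaPlaqsTop Ω Ω₀ m)
   (ε_m·η_m²)`, `Sect2.CoDivSmallOn (Sect2.omegaBondsTop Ω Ω₀ m) (ε_m·η_m³)`, `m ≤ kT` — give `InAk L k η α Ω′ (zdLift U)` for ANY cover family `Ω′` whose level-`j`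
   set projects into the torus level set of a chosen torus scale `lvl j ≤ kT` with `ε_{lvl j}·η_{lvl j}^{2,3} ≤ α·η_j^{2,3}` — print's «we can drop out the domains
   Ω_{j′}» read on the cover: the member of the sequel takes `lvl j = n − 1` below the cube's scale and `lvl n = n`, so ONE `α = ε_{n−1} ⊔ L²… ` serves and the far
   torus scales are never read).
HONEST FRAMING: pure bookkeeping between two typings already in the tree — NO estimate, nothing of Bałaban asserted or discharged; N07 ∕ N05 ∕ K0⁶ NOT discharged;
counts unmoved (5∕27); one finite T⁴ programme at fixed ε — NOT continuum ∕ ℝ⁴ ∕ infinite volume ∕ OS ∕ mass gap ∕ Clay.  No `sorry`, no `instance`, no `notation`.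
-/

noncomputable section

namespace Literature.MathematicalPhysics.QuantumFieldTheory.Balaban1983to89.Node00

open scoped Matrix.Norms.L2Operator
open B15Eq112TorusCover (cover per cover_add_pmul)
open B15LatticeCubeTorus (pmul)
open B14DomainGeom (Pt)
open B7Prop1Explicit (e hol stepHol plaqWord)
open B7Prop1Local (hol_plaqWord_eq)
open B7Prop2Explicit (unitaryUnits mem_unitaryUnits)
open B7Eq78Linearization (conjR conjR_apply)
open B8Ineq132 (plaqF covDeriv covDiv PlaqTouches BondTouches CondAt InAk)
open B8Eq17ClassAkV1 (plaqsOf)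
open B15DeterminingSets (bondsOf)

/-! ## §1  The periodic lift `zdLift` and the plaquette dictionary -/

section Lift

variable {P : Params} {N : ℕ}

/-- **THE PERIODIC LIFT OF A TORUS GAUGE FIELD TO n05-a's `ℤᵈ × M_N(ℂ)ˣ` CARRIER**: `V(x, x + e_μ) := ι(U(π x, π x + e_μ))`, `π = cover P` the universal cover
`ℤᵈ → T_η = T^{(0)}` ([I] p. 251: the torus «obtained by the usual identification of boundary points of the cube»; [6] p. 77: configurations on `T_η`).
[cite: Balaban1987RG1, (0.1) p.251; Balaban1985RegularSpaces, (1.3) p.77] -/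
def zdLift (N : ℕ) (U : GaugeField P 0 (SU N)) : B7Prop1Explicit.Site P.d → Fin P.d → (MatA N)ˣ :=
  fun x μ => ιSU N (U ⟨cover P x, μ⟩)

/-- The lift, bond by bond. [cite: Balaban1987RG1, (0.1) p.251 (bookkeeping)] -/
@[simp] theorem zdLift_apply (U : GaugeField P 0 (SU N)) (x : B7Prop1Explicit.Site P.d) (μ : Fin P.d) :
    zdLift N U x μ = ιSU N (U ⟨cover P x, μ⟩) := rfl

/-- The cover intertwines the unit steps: `π (x + e_μ) = (π x) + e_μ`. [cite: Balaban1987RG1, (0.1) p.251 (the torus)] -/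
theorem cover_add_e (x : B7Prop1Explicit.Site P.d) (μ : Fin P.d) : cover P (x + e μ) = (cover P x).shift μ :=
  B15Claim189CubePin.cover_add_single x μ

/-- `(y + e_μ) − e_μ = y` on the torus. [cite: Balaban1987RG1, (0.1) p.251 (bookkeeping)] -/
theorem unshift_shift_site (y : Site P 0) (μ : Fin P.d) : (y.shift μ).unshift μ = y := by
  funext ν
  by_cases h : ν = μ
  · subst h; simp [Site.shift, Site.unshift]
  · simp [Site.shift, Site.unshift, Function.update_of_ne h]

/-- The cover intertwines the backward unit steps: `π (x − e_μ) = (π x) − e_μ`. [cite: Balaban1987RG1, (0.1) p.251 (the torus)] -/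
theorem cover_sub_e (x : B7Prop1Explicit.Site P.d) (μ : Fin P.d) : cover P (x - e μ) = (cover P x).unshift μ := by
  have h := cover_add_e (P := P) (x - e μ) μ
  rw [sub_add_cancel] at h
  rw [h, unshift_shift_site]

/-- **DECK PERIODICITY**: the lift is invariant under the deck translations `x ↦ x + (2L^{m+K})·v` of the cover. [cite: Balaban1987RG1, (0.1) p.251] -/
theorem zdLift_add_pmul (U : GaugeField P 0 (SU N)) (x v : B7Prop1Explicit.Site P.d) (μ : Fin P.d) :
    zdLift N U (x + pmul (per P) v) μ = zdLift N U x μ := by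
  simp only [zdLift_apply, cover_add_pmul]

/-- The lift is UNITARY-valued (`SU(N) ≤ U(N) = 𝒰(M_N(ℂ))`): it lies in the configuration space of n05-a's members `zdGF3 ∕ zdCub`.
[cite: Balaban1985RegularSpaces, p.77 («G-valued», G ⊂ U(N)); Balaban1985Averaging, (19) p.21] -/
theorem zdLift_mem_unitaryUnits (U : GaugeField P 0 (SU N)) (x : B7Prop1Explicit.Site P.d) (μ : Fin P.d) :
    zdLift N U x μ ∈ unitaryUnits (MatA N) := by
  rw [mem_unitaryUnits, zdLift_apply, coe_ιSU]
  exact Matrix.specialUnitaryGroup_le_unitaryGroup (U ⟨cover P x, μ⟩).prop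

/-- Reversing the orientation of a plaquette inverts its holonomy (any group): `V(∂p_{νμ}(x)) = V(∂p_{μν}(x))⁻¹`. [cite: Balaban1985Averaging, (9) p.18] -/
theorem hol_plaqWord_swap {G : Type*} [Group G] {d : ℕ} (V : B7Prop1Explicit.Site d → Fin d → G) (x : B7Prop1Explicit.Site d) (μ ν : Fin d) :
    hol V x (plaqWord ν μ) = (hol V x (plaqWord μ ν))⁻¹ := by
  rw [hol_plaqWord_eq, hol_plaqWord_eq]
  simp only [mul_inv_rev, inv_inv, mul_assoc]

variable [NeZero N]

/-- **THE LIFT INTERTWINES THE GAUGE ACTIONS** ((8) of [3] on the torus and on the cover): `zdLift (U^g) = (zdLift U)^{ι ∘ g ∘ π}`.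
[cite: Balaban1985Averaging, (8) p.18] -/
theorem zdLift_gaugeAct (g : GaugeTransf P 0 (SU N)) (U : GaugeField P 0 (SU N)) :
    zdLift N (GaugeField.gaugeAct g U) = B7Prop1Explicit.gaugeAct (fun x => ιSU N (g (cover P x))) (zdLift N U) := by
  funext x μ
  simp only [zdLift_apply, B7Prop1Explicit.gaugeAct, cover_add_e]
  rw [GaugeField.gaugeAct, map_mul, map_mul, map_inv]
  rfl

/-- The plaquette holonomy of the lift IS the embedded torus plaquette variable: `V(∂p_{μν}(x)) = ι(U(∂p_{μν}(π x)))`, `μ < ν`.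
[cite: Balaban1985RegularSpaces, (1.2) p.76; Balaban1985Averaging, (9) p.18] -/
theorem hol_zdLift_plaqWord (U : GaugeField P 0 (SU N)) (x : B7Prop1Explicit.Site P.d) {μ ν : Fin P.d} (h : μ < ν) :
    hol (zdLift N U) x (plaqWord μ ν) = ιSU N (GaugeField.plaqHol U ⟨cover P x, μ, ν, h⟩) := by
  rw [hol_plaqWord_eq, GaugeField.plaqHol, map_mul, map_mul, map_mul, map_inv, map_inv]
  simp only [zdLift_apply, cover_add_e]

/-- ★ **[6] (1.2)'s PLAQUETTE FIELD OF THE LIFT**, positive orientation: `F_{μν}(x) = ι(U(∂p_{μν}(π x)))` (`μ < ν`) — node00-def-P11's `Sect2.plaqMat` read on the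
cover. [cite: Balaban1985RegularSpaces, (1.2) p.76] -/
theorem plaqF_zdLift_of_lt (U : GaugeField P 0 (SU N)) (x : B7Prop1Explicit.Site P.d) {μ ν : Fin P.d} (h : μ < ν) :
    plaqF (zdLift N U) μ ν x = Sect2.plaqMat U (cover P x) μ ν h := by
  unfold plaqF Sect2.plaqMat
  rw [hol_zdLift_plaqWord U x h]

/-- ★ The plaquette field of the lift, negative orientation: `F_{μν}(x) = ι(U(∂p_{νμ}(π x)))⁻¹` (`ν < μ`). [cite: Balaban1985RegularSpaces, (1.2) p.76] -/
theorem plaqF_zdLift_of_gt (U : GaugeField P 0 (SU N)) (x : B7Prop1Explicit.Site P.d) {μ ν : Fin P.d} (h : ν < μ) :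
    plaqF (zdLift N U) μ ν x = (((ιSU N (GaugeField.plaqHol U ⟨cover P x, ν, μ, h⟩))⁻¹ : (MatA N)ˣ) : MatA N) := by
  unfold plaqF
  rw [hol_plaqWord_swap, hol_zdLift_plaqWord U x h]

/-- ★ `‖F_{μν}(x) − 1‖ = |U(∂p_{μν}(π x)) − 1|` (`μ < ν`): [6] (1.7)'s quantity on the cover IS the record's `dist1` of the torus plaquette variable.
[cite: Balaban1985RegularSpaces, (1.7) p.77; Balaban1985Averaging, (19) p.21] -/
theorem norm_plaqF_zdLift_sub_one_of_lt (U : GaugeField P 0 (SU N)) (x : B7Prop1Explicit.Site P.d) {μ ν : Fin P.d} (h : μ < ν) :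
    ‖plaqF (zdLift N U) μ ν x - 1‖ = dist1 (GaugeField.plaqHol U ⟨cover P x, μ, ν, h⟩) := by
  rw [plaqF_zdLift_of_lt U x h, Sect2.plaqMat, coe_ιSU, dist1_su_eq_norm]

/-- ★ `‖F_{μν}(x) − 1‖ = |U(∂p_{νμ}(π x)) − 1|` (`ν < μ`): reversing the orientation does not change the distance to `1` (`|g⁻¹ − 1| = |g − 1|` in `SU(N)`).
[cite: Balaban1985RegularSpaces, (1.7) p.77; Balaban1985Averaging, (19) p.21] -/
theorem norm_plaqF_zdLift_sub_one_of_gt (U : GaugeField P 0 (SU N)) (x : B7Prop1Explicit.Site P.d) {μ ν : Fin P.d} (h : ν < μ) :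
    ‖plaqF (zdLift N U) μ ν x - 1‖ = dist1 (GaugeField.plaqHol U ⟨cover P x, ν, μ, h⟩) := by
  rw [plaqF_zdLift_of_gt U x h, ← map_inv, coe_ιSU, ← dist1_su_eq_norm]
  exact GaugeGroup.dist1_inv _

end Lift

/-! ## §2  [6] (1.2): the covariant co-divergence of the lift is `η⁻¹ •` node00-def-P11's `Sect2.coDivSum` on the torus -/

section CoDivergence

variable {P : Params} {N : ℕ} [NeZero N]

/-- One term of (1.2) on the cover: `(D^{η*}_{V,ν}F_{αβ})(x) = η⁻¹·[R(V(x, x−e_ν))F_{αβ}(x−e_ν) − F_{αβ}(x)]` IS `η⁻¹ • Sect2.coDivTerm U (π x) ν α β` (`α < β`).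
[cite: Balaban1985RegularSpaces, (1.1)–(1.2) p.76] -/
theorem covDeriv_zdLift_plaqF (η : ℝ) (U : GaugeField P 0 (SU N)) (x : B7Prop1Explicit.Site P.d) (ν : Fin P.d) {α β : Fin P.d} (h : α < β) :
    covDeriv η (zdLift N U) ν (plaqF (zdLift N U) α β) x = η⁻¹ • Sect2.coDivTerm U (cover P x) ν α β h := by
  unfold covDeriv Sect2.coDivTerm
  simp only [conjR_apply, inv_inv, plaqF_zdLift_of_lt U _ h, zdLift_apply, cover_sub_e, map_inv]

/-- ★★ **[6] (1.2) OF THE LIFT IS THE RECORD'S LATTICE YANG–MILLS CURRENT READ ON THE COVER**: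
`(D^{η*}_V ∂V)_μ(x) = η⁻¹ • Sect2.coDivSum U (π x) μ` (`Σ_{ν<μ}(D^{η*}_{V,ν}F_{νμ})(x) − Σ_{ν>μ}(D^{η*}_{V,ν}F_{μν})(x)` versus node00-def-P11's signed sum over all `ν`).
[cite: Balaban1985RegularSpaces, (1.2) p.76, (1.9) p.77] -/
theorem covDiv_zdLift (η : ℝ) (U : GaugeField P 0 (SU N)) (μ : Fin P.d) (x : B7Prop1Explicit.Site P.d) :
    covDiv η (zdLift N U) μ x = η⁻¹ • Sect2.coDivSum U (cover P x) μ := by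
  -- the signed summand of `Sect2.coDivSum`
  set g : Fin P.d → MatA N := fun ν =>
    if h : ν < μ then Sect2.coDivTerm U (cover P x) ν ν μ h
    else if h' : μ < ν then -Sect2.coDivTerm U (cover P x) ν μ ν h' else 0 with hg
  have hsum : Sect2.coDivSum U (cover P x) μ = ∑ ν, g ν := rfl
  have hIio : ∀ ν ∈ Finset.Iio μ, η⁻¹ • g ν = covDeriv η (zdLift N U) ν (plaqF (zdLift N U) ν μ) x := by
    intro ν hν
    have hlt : ν < μ := Finset.mem_Iio.1 hν
    simp only [hg, dif_pos hlt]
    rw [covDeriv_zdLift_plaqF η U x ν hlt]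
  have hIoi : ∀ ν ∈ Finset.Ioi μ, η⁻¹ • g ν = -covDeriv η (zdLift N U) ν (plaqF (zdLift N U) μ ν) x := by
    intro ν hν
    have hlt : μ < ν := Finset.mem_Ioi.1 hν
    have hnlt : ¬ν < μ := not_lt.2 hlt.le
    simp only [hg, dif_neg hnlt, dif_pos hlt, smul_neg]
    rw [covDeriv_zdLift_plaqF η U x ν hlt]
  have hrest : ∀ ν ∈ (Finset.Iio μ)ᶜ \ Finset.Ioi μ, η⁻¹ • g ν = 0 := by
    intro ν hν
    rw [Finset.mem_sdiff, Finset.mem_compl, Finset.mem_Iio, Finset.mem_Ioi] at hν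
    simp only [hg, dif_neg hν.1, dif_neg hν.2, smul_zero]
  have hsub : Finset.Ioi μ ⊆ (Finset.Iio μ)ᶜ := by
    intro ν hν
    rw [Finset.mem_compl, Finset.mem_Iio]
    exact not_lt.2 (Finset.mem_Ioi.1 hν).le
  rw [hsum, Finset.smul_sum, ← Finset.sum_add_sum_compl (Finset.Iio μ), ← Finset.sum_sdiff hsub,
    Finset.sum_eq_zero hrest, zero_add, Finset.sum_congr rfl hIio, Finset.sum_congr rfl hIoi, Finset.sum_neg_distrib]
  unfold covDiv
  rw [sub_eq_add_neg]

/-- The norm of (1.2) on the cover: `‖(D^{η*}_V ∂V)_μ(x)‖ = η⁻¹·‖Sect2.coDivSum U (π x) μ‖` (`η > 0`). [cite: Balaban1985RegularSpaces, (1.2) p.76, (1.9) p.77] -/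
theorem norm_covDiv_zdLift {η : ℝ} (hη : 0 < η) (U : GaugeField P 0 (SU N)) (μ : Fin P.d) (x : B7Prop1Explicit.Site P.d) :
    ‖covDiv η (zdLift N U) μ x‖ = η⁻¹ * ‖Sect2.coDivSum U (cover P x) μ‖ := by
  rw [covDiv_zdLift, norm_smul, Real.norm_eq_abs, abs_of_pos (inv_pos.2 hη)]

end CoDivergence

/-! ## §3  «p ∈ Ω», «b ∈ Ω» ([6] p. 77) on the cover versus on the torus -/

section Touching

variable {P : Params}

/-- A plaquette of the cover MEETING `Y` ([6] p. 77: at least one corner in `Y`) projects to a torus plaquette meeting `π '' Y` (positive orientation `μ < ν`).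
[cite: Balaban1985RegularSpaces, p.77 (convention before (1.5))] -/
theorem mem_plaqsOf_image_of_plaqTouches {Y : Set (B7Prop1Explicit.Site P.d)} {x : B7Prop1Explicit.Site P.d} {μ ν : Fin P.d}
    (hp : PlaqTouches Y x μ ν) (h : μ < ν) : (⟨cover P x, μ, ν, h⟩ : Plaq P 0) ∈ plaqsOf (cover P '' Y) := by
  simp only [plaqsOf, Set.mem_setOf_eq, ← cover_add_e]
  rcases hp with hx | hx | hx | hx
  · exact Or.inl (Set.mem_image_of_mem _ hx)
  · exact Or.inr (Or.inl (Set.mem_image_of_mem _ hx))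
  · exact Or.inr (Or.inr (Or.inl (Set.mem_image_of_mem _ hx)))
  · exact Or.inr (Or.inr (Or.inr (Set.mem_image_of_mem _ hx)))

/-- The same for the negative orientation `ν < μ`: the reversed torus plaquette `p_{νμ}(π x)` meets `π '' Y`. [cite: Balaban1985RegularSpaces, p.77 (convention before (1.5))] -/
theorem mem_plaqsOf_image_of_plaqTouches_swap {Y : Set (B7Prop1Explicit.Site P.d)} {x : B7Prop1Explicit.Site P.d} {μ ν : Fin P.d}
    (hp : PlaqTouches Y x μ ν) (h : ν < μ) : (⟨cover P x, ν, μ, h⟩ : Plaq P 0) ∈ plaqsOf (cover P '' Y) := by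
  have hp' : PlaqTouches Y x ν μ := by
    rcases hp with hx | hx | hx | hx
    · exact Or.inl hx
    · exact Or.inr (Or.inr (Or.inl hx))
    · exact Or.inr (Or.inl hx)
    · exact Or.inr (Or.inr (Or.inr (by rwa [add_right_comm] at hx)))
  exact mem_plaqsOf_image_of_plaqTouches hp' h

/-- A bond of the cover MEETING `Y` ([6] p. 77: at least one end-point in `Y`) projects to a torus bond meeting `π '' Y`. [cite: Balaban1985RegularSpaces, p.77 (convention before (1.5))] -/
theorem mem_bondsOf_image_of_bondTouches {Y : Set (B7Prop1Explicit.Site P.d)} {x : B7Prop1Explicit.Site P.d} {μ : Fin P.d}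
    (hb : BondTouches Y x μ) : (⟨cover P x, μ⟩ : PBond P 0) ∈ bondsOf (cover P '' Y) := by
  simp only [bondsOf, Set.mem_setOf_eq, PBond.tgt, ← cover_add_e]
  rcases hb with hx | hx
  · exact Or.inl (Set.mem_image_of_mem _ hx)
  · exact Or.inr (Set.mem_image_of_mem _ hx)

end Touching

/-! ## §4  [6] (1.7) ∧ (1.9) for the lift, READ FROM the torus class bounds: `CondAt`, `InAk` -/

section ClassTransfer

variable {P : Params} {N : ℕ} [NeZero N]

/-- ★★ **[6] (1.7) ∧ (1.9) AT SCALE `j` ON A COVER SET `Y` FOR THE LIFT, FROM THE TORUS BOUNDS ON `π '' Y`**: `|U(∂p) − 1| < αL^{−2j}` on the torus plaquettes meeting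
`π '' Y` and `‖η·(D^{η*}_U ∂U)(b)‖ < αL^{−2j}·L^{−j}` (node00-def-P11's η-free normalisation) on the torus bonds meeting `π '' Y` give `B8Ineq132.CondAt L η α j Y (zdLift U)`
for every spacing `η > 0` (the spacing cancels against print's threshold `αL^{−2j}(L^jη)^{−1}`). [cite: Balaban1985RegularSpaces, (1.7), (1.9) p.77] -/
theorem condAt_zdLift {Y : Set (B7Prop1Explicit.Site P.d)} {j : ℕ} {α η : ℝ} (hη : 0 < η) (U : GaugeField P 0 (SU N))
    (hP : PlaqSmallOn (plaqsOf (cover P '' Y)) (α * (((P.L : ℝ) ^ j)⁻¹) ^ 2) U)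
    (hD : Sect2.CoDivSmallOn (bondsOf (cover P '' Y)) (α * (((P.L : ℝ) ^ j)⁻¹) ^ 2 * ((P.L : ℝ) ^ j)⁻¹) U) :
    CondAt P.L η α j Y (zdLift N U) := by
  refine ⟨fun x μ ν hne hp => ?_, fun x μ hb => ?_⟩
  · rcases lt_or_gt_of_ne hne with h | h
    · rw [norm_plaqF_zdLift_sub_one_of_lt U x h]
      exact hP _ (mem_plaqsOf_image_of_plaqTouches hp h)
    · rw [norm_plaqF_zdLift_sub_one_of_gt U x h]
      exact hP _ (mem_plaqsOf_image_of_plaqTouches_swap hp h)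
  · rw [norm_covDiv_zdLift hη]
    have hb' := hD _ (mem_bondsOf_image_of_bondTouches hb)
    have hLj : 0 < (P.L : ℝ) ^ j := pow_pos (Nat.cast_pos.2 P.L_pos) j
    calc η⁻¹ * ‖Sect2.coDivSum U (cover P x) μ‖ < η⁻¹ * (α * (((P.L : ℝ) ^ j)⁻¹) ^ 2 * ((P.L : ℝ) ^ j)⁻¹) :=
          mul_lt_mul_of_pos_left hb' (inv_pos.2 hη)
      _ = α * (((P.L : ℝ) ^ j)⁻¹) ^ 2 * ((P.L : ℝ) ^ j * η)⁻¹ := by rw [mul_inv]; ring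

/-- The record's spacing letters: `η_j² = (L^j)⁻²`, `η_j³ = (L^j)⁻²·(L^j)⁻¹` (`Params.eta j = (L⁻¹)^j`). [cite: Balaban1987RG1, (1.1) p.260 (bookkeeping)] -/
theorem eta_sq_and_cube_eq (P : Params) (j : ℕ) : P.eta j ^ 2 = (((P.L : ℝ) ^ j)⁻¹) ^ 2 ∧ P.eta j ^ 3 = (((P.L : ℝ) ^ j)⁻¹) ^ 2 * ((P.L : ℝ) ^ j)⁻¹ := by
  have h : P.eta j = ((P.L : ℝ) ^ j)⁻¹ := by rw [Params.eta, inv_pow]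
  rw [h]
  exact ⟨rfl, by ring⟩

/-- ★★ The same in the record's currency `α·η_j²` ∕ `α·η_j³` (`PlaqSmallOn … (α * P.eta j ^ 2)`, `Sect2.CoDivSmallOn … (α * P.eta j ^ 3)`).
[cite: Balaban1985RegularSpaces, (1.7)–(1.9) p.77; Balaban1985Variational, (2) p.278] -/
theorem condAt_zdLift_eta {Y : Set (B7Prop1Explicit.Site P.d)} {j : ℕ} {α η : ℝ} (hη : 0 < η) (U : GaugeField P 0 (SU N))
    (hP : PlaqSmallOn (plaqsOf (cover P '' Y)) (α * P.eta j ^ 2) U)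
    (hD : Sect2.CoDivSmallOn (bondsOf (cover P '' Y)) (α * P.eta j ^ 3) U) :
    CondAt P.L η α j Y (zdLift N U) := by
  obtain ⟨h2, h3⟩ := eta_sq_and_cube_eq P j
  rw [h2] at hP
  rw [h3, ← mul_assoc] at hD
  exact condAt_zdLift hη U hP hD

/-- ★★ **`zdLift U ∈ 𝔄_k({Ω′_j}, α)` ON THE COVER** ([6] (1.7) ∧ (1.9) at every scale `j ≤ k`, `B8Ineq132.InAk`) from the torus bounds level by level on the cover
images `π '' Ω′_j`. [cite: Balaban1985RegularSpaces, (1.7)–(1.9) p.77 (definition of 𝔄_k({Ω_j}, α₀))] -/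
theorem inAk_zdLift {Ω' : ℕ → Set (B7Prop1Explicit.Site P.d)} {k : ℕ} {α η : ℝ} (hη : 0 < η) (U : GaugeField P 0 (SU N))
    (hP : ∀ j, j ≤ k → PlaqSmallOn (plaqsOf (cover P '' Ω' j)) (α * P.eta j ^ 2) U)
    (hD : ∀ j, j ≤ k → Sect2.CoDivSmallOn (bondsOf (cover P '' Ω' j)) (α * P.eta j ^ 3) U) :
    InAk P.L k η α Ω' (zdLift N U) :=
  fun j hj => condAt_zdLift_eta hη U (hP j hj) (hD j hj)

/-- Shrinking the plaquette set and weakening the threshold of the record's `PlaqSmallOn`. [cite: Balaban1988Convergent, (1.4) p.247 (bookkeeping)] -/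
theorem plaqSmallOn_mono_of_le {j : ℕ} {G : Type*} [GaugeGroup G] {S T : Set (Plaq P j)} {δ δ' : ℝ} {U : GaugeField P j G}
    (h : PlaqSmallOn T δ U) (hST : S ⊆ T) (hδ : δ ≤ δ') : PlaqSmallOn S δ' U :=
  fun p hp => (h p (hST hp)).trans_le hδ

/-- «b ∈ S» is monotone in the site set. [cite: Balaban1985RegularSpaces, p.77 (convention before (1.5); bookkeeping)] -/
theorem bondsOf_subset_of_subset {j : ℕ} {S T : Set (Site P j)} (h : S ⊆ T) : bondsOf S ⊆ bondsOf T :=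
  fun _ hb => hb.imp (fun hs => h hs) (fun ht => h ht)

/-- `plaqsOf` and `bondsOf` read the torus level set of scale `m` of the top-domain reading (`Ω₀` at `m = 0`, `Ω_m` at `m ≥ 1`).
[cite: Balaban1985Variational, (2) p.278; Balaban1985RegularSpaces, (1.7)–(1.9) p.77 (bookkeeping)] -/
theorem omegaPlaqsTop_eq_plaqsOf (Ω : ℕ → Set (Site P 0)) (Ω₀ : Set (Site P 0)) (m : ℕ) :
    Sect2.omegaPlaqsTop Ω Ω₀ m = plaqsOf (if m = 0 then Ω₀ else Ω m) ∧ Sect2.omegaBondsTop Ω Ω₀ m = bondsOf (if m = 0 then Ω₀ else Ω m) :=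
  ⟨rfl, rfl⟩

/-- ★★ **THE READING THE SEQUEL USES — print's «we can drop out the domains Ω_{j′}» on the cover.**  Torus side: the class hypotheses of
`Node00.Gauge152OfClassTopStep` — `|U(∂p) − 1| < ε_m·η_m²` on `Sect2.omegaPlaqsTop Ω Ω₀ m`, `‖η·(D^{η*}_U∂U)(b)‖ < ε_m·η_m³` on `Sect2.omegaBondsTop Ω Ω₀ m`,
all `m ≤ kT`.  Cover side: ANY family `Ω′` and a choice, for each cover scale `j ≤ k`, of a torus scale `lvl j ≤ kT` whose level set contains `π '' Ω′_j` and whose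
threshold is dominated, `ε_{lvl j}·η_{lvl j}² ≤ α·η_j²`, `ε_{lvl j}·η_{lvl j}³ ≤ α·η_j³`.  Then `zdLift U ∈ 𝔄_k({Ω′_j}, α)`.  (FILE 26 takes `Ω′_j` = the lifted collared
cube for `j < n` with `lvl j = n − 1`, and `Ω′_n = π⁻¹Ω_n ∩ □̃` with `lvl n = n`: the far torus scales are never read and ONE `α` serves.)
[cite: Balaban1985RegularSpaces, (1.7)–(1.9) p.77, p.98 («we can drop out the domains Ω_{j′}, j′ > j, from our assumptions»); Balaban1985Variational, (2) p.278, (144)–(146) pp.300–301] -/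
theorem inAk_zdLift_of_top {Ω : ℕ → Set (Site P 0)} {Ω₀ : Set (Site P 0)} {kT : ℕ} {ε : ℕ → ℝ} (U : GaugeField P 0 (SU N))
    (hP : ∀ m, m ≤ kT → PlaqSmallOn (Sect2.omegaPlaqsTop Ω Ω₀ m) (ε m * P.eta m ^ 2) U)
    (hD : ∀ m, m ≤ kT → Sect2.CoDivSmallOn (Sect2.omegaBondsTop Ω Ω₀ m) (ε m * P.eta m ^ 3) U)
    {Ω' : ℕ → Set (B7Prop1Explicit.Site P.d)} {k : ℕ} {α η : ℝ} (hη : 0 < η) (lvl : ℕ → ℕ)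
    (hlvl : ∀ j, j ≤ k → lvl j ≤ kT)
    (hsub : ∀ j, j ≤ k → cover P '' Ω' j ⊆ (if lvl j = 0 then Ω₀ else Ω (lvl j)))
    (htol2 : ∀ j, j ≤ k → ε (lvl j) * P.eta (lvl j) ^ 2 ≤ α * P.eta j ^ 2)
    (htol3 : ∀ j, j ≤ k → ε (lvl j) * P.eta (lvl j) ^ 3 ≤ α * P.eta j ^ 3) :
    InAk P.L k η α Ω' (zdLift N U) := by
  refine inAk_zdLift hη U (fun j hj => ?_) (fun j hj => ?_)
  · have h := hP (lvl j) (hlvl j hj)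
    rw [(omegaPlaqsTop_eq_plaqsOf Ω Ω₀ (lvl j)).1] at h
    exact plaqSmallOn_mono_of_le h (B8Eq17ClassAkV1.plaqsOf_mono (hsub j hj)) (htol2 j hj)
  · have h := hD (lvl j) (hlvl j hj)
    rw [(omegaPlaqsTop_eq_plaqsOf Ω Ω₀ (lvl j)).2] at h
    exact (h.mono (bondsOf_subset_of_subset (hsub j hj))).of_le (htol3 j hj)

end ClassTransfer

end Literature.MathematicalPhysics.QuantumFieldTheory.Balaban1983to89.Node00

end
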